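import Literature.AlgebraicGeometry.Motives.AbelianVarietyRelFrobeniusDegree
import Literature.AlgebraicGeometry.Motives.AbelianVarietyIsogenyProofs
import Literature.AlgebraicGeometry.GroupSchemes.GroupSchemeKernelShear
import Literature.AlgebraicGeometry.GroupSchemes.InfinitesimalToUnramifiedTrivial
import Literature.AlgebraicGeometry.Morphisms.ClosedImmersionOfEqualRank
import HarnessLib

/-!
# An isogeny with étale kernel restricts to an isomorphism on Frobenius kernels

Topic `Literature/AlgebraicGeometry/Motives`; namespaces `Literature.AlgebraicGeometry.GroupSchemes.GroupSchemeKernel`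
(§1–§2, generic: a commuting square of homomorphisms of `S`-group schemes and the map it induces on kernels) and
`Literature.AlgebraicGeometry.Motives.AbelianVariety` (§3, abelian varieties).  THEOREMS ONLY (no definition, no named
fact, no instance, no notation, no `sorry`).  Cell `hodgecm-mathlib` (D-0151), FLOOR 0, P6 «MOD programme» (crux
hLiu418 = stmt-HodgeConjecture-24832), DICT organ **(o-c3g)** of desk F0P6c-plan (2026-09-01T14:26Z ∕ 14:33Z; census
of record F0P6-p14 (g0) 14:28Z): for an isogeny `φ : A → B` of abelian varieties over a perfect field `k` of exponential
characteristic `p` whose kernel `Ker φ` is ÉTALE over `k`, and every `n`, the homomorphism induced by `φ` on the kernels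
of the relative `pⁿ`-Frobenii (★ `AbelianVariety.relFrobenius`, naturality ★ `relFrobenius_comp`)
  `ψ = kerLift (ι_A ≫ φ) : Ker Fⁿ_{A∕k} ⟶ Ker Fⁿ_{B∕k}`
is an ISOMORPHISM of `k`-group schemes.  Consumer: HEART letter (c3b) (the Frobenius of the reduced point is the
quotient by `Ker F_q`, transported through the étale quotient `𝒜_x̄ → 𝒜_x̄ ∕ H_ét`).  HC_CM is proved only modulo the
printed citations until rung 0 closes; this file is generic and changes no count.

THE PRINT.  [MumfordAV1970] §15 (p. 146: the Frobenius morphism is an isogeny of degree `p^g`), §14 (pp. 132–142: a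
finite commutative group scheme over a perfect field splits as local × reduced; homomorphisms respect the splitting, so
an isogeny with reduced = étale kernel does not touch the local part); [Tate1997FiniteFlatGroupSchemes] (3.7)
(connected–étale sequence; no non-trivial homomorphism from a connected group to an étale one);
[GortzWedhorn2020] Definition 4.45 (2) (p. 117) (kernels as fibre products); [StacksProject] Tag 02KA (ranks of
finite locally free morphisms).

PROOF (p14's census, all pieces ★).  For a commuting square of homomorphisms `φ ≫ F' = F ≫ φ'` (`F : G → G'`,
`F' : H → H'`, `φ : G → H`, `φ' : G' → H'`) the composite `Ker F → G → H` is killed by `F'`, whence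
`ψ := kerLift (ι_F ≫ φ) : Ker F → Ker F'`, a homomorphism (§1).  If `Ker F` has ONE POINT and `Ker φ → S` is unramified
(e.g. étale), then `Ker ψ` — a closed subgroup of `Ker F`, so one-point, mapping by the unramified homomorphism
`kerLift (ι_ψ ≫ ι_F) : Ker ψ → Ker φ` (its composite with the closed immersion `Ker φ → G` is the closed immersion
`Ker ψ → Ker F → G`) into `Ker φ` — is TRIVIAL by ★ `isIso_unit_of_subsingleton_of_hom` («Hom(infinitesimal, unramified)
= 1», (E1′)), so `ψ` is a MONOMORPHISM (kernel shear ★ `inv_mul_comp_eq_toUnit_comp_unit`), hence — `ψ.left` being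
finite (`ψ ≫ ι_{F'} = ι_F ≫ φ`) — a closed immersion (Mathlib `IsClosedImmersion.iff_isFinite_and_mono`); a closed
immersion between finite flat `S`-schemes of the same rank is an isomorphism (★ (o-c2c)
`Over.isIso_of_isClosedImmersion_of_finrank_eq`) (§2).  For abelian varieties (§3): `F = Fⁿ_{A∕k}`, `F' = Fⁿ_{B∕k}`,
`φ' = φ^{(pⁿ)}`; `Ker Fⁿ_{A∕k}` has one point because `Fⁿ_{A∕k}` is injective on points (★
`relFrobeniusOver_base_bijective`), and is finite flat of rank `deg Fⁿ_{A∕k} = p^{n·dim A}` (base change of the rank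
function of the finite flat isogeny `F`, ★ `IsIsogeny.finrank_eq_kerRank`, ★ `kerRank_relFrobenius`), with
`dim A = dim B` (★ `dim_eq_of_isIsogeny`).

* §1 (any base `S`; `G H G' H'` group objects of `Over S`) `kerι_comp_comp_eq_one_of_sq` (hypothesis of `kerLift`),
  `mono_of_isIso_unit_ker` («trivial kernel ⇒ mono»), `snd_left_eq_ker_hom`, `isFinite_ker_hom_of_isFinite_left`,
  `flat_ker_hom_of_flat_left`, `finrank_ker_hom_eq_finrank_left`, `subsingleton_ker_left_of_injective`.
* §2 `mono_kerLift_of_subsingleton_of_unramified` (the (E1′) step), `isFinite_kerLift_left`,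
  `isClosedImmersion_kerLift_left_of_subsingleton_of_unramified`, **`isIso_kerLift_of_finrank_eq`**.
* §3 (abelian varieties) `hom_hom_hom_comp_relFrobenius`, `subsingleton_ker_relFrobenius_left`,
  `isFinite_ker_relFrobenius_hom`, `flat_ker_relFrobenius_hom`, `finrank_ker_relFrobenius_hom` (`p^{n·dim A}`), HEAD
  **`isIso_frobKerLift`** (+ `_left`).

FALSE VARIANT: for `φ = F_{A∕k}` itself (kernel `Ker F`, not étale when `dim A > 0`, `p > 1`) the induced map
`Ker F_A → Ker F_{A^{(p)}}` is trivial, not an isomorphism — étaleness of `Ker φ` is what rules this out.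

## References
* [MumfordAV1970] D. Mumford, *Abelian Varieties* (1970), §14 (pp. 132–142), §15 (p. 146).
* [Tate1997FiniteFlatGroupSchemes] J. Tate, *Finite flat group schemes* (1997), (3.7).
* [GortzWedhorn2020] U. Görtz, T. Wedhorn, *Algebraic Geometry I*, 2nd ed. (2020), Definition 4.45 (2) (p. 117).
* [StacksProject] The Stacks Project, Tag 02KA.
-/

set_option autoImplicit false

noncomputable section

-- `(f ≫ g).hom.hom.hom`, `Grp (SchemeOver k)` as an induced category and `(𝟙_ (Over S)).left = S` are definitional
-- only above `instances` transparency (as in ★ `AbelianVarietyFrobeniusTwistVariety`, ★ `RelativeFrobeniusKernel`).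
set_option backward.isDefEq.respectTransparency false

open CategoryTheory CategoryTheory.Limits AlgebraicGeometry MonoidalCategory CartesianMonoidalCategory

open scoped MonObj

universe u

/-! ## §1 Kernels of homomorphisms of `S`-group schemes: trivial kernel ⇒ mono; finiteness, flatness, rank, one point -/

namespace Literature.AlgebraicGeometry.GroupSchemes.GroupSchemeKernel

variable {S : Scheme.{u}}

section Generic

variable {G G' : Over S} [GrpObj G']

/-- **A homomorphism of `S`-group schemes with TRIVIAL kernel is a monomorphism**: if the unit `𝟙 ⟶ Ker ψ` is an
isomorphism, then `ψ` is mono — two `T`-points `a, b` with `a ≫ ψ = b ≫ ψ` have `a⁻¹ b` in the kernel (kernel shear ★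
`inv_mul_comp_eq_toUnit_comp_unit`), which is the unit. [cite: GortzWedhorn2020, Definition 4.45 (2) (p. 117)] -/
theorem mono_of_isIso_unit_ker {K L : Over S} [GrpObj K] [GrpObj L] (ψ : K ⟶ L) [IsMonHom ψ]
    [IsIso (η[ker ψ] : 𝟙_ (Over S) ⟶ ker ψ)] : Mono ψ := by
  refine ⟨fun {T} a b hab => ?_⟩
  have h : (a⁻¹ * b) ≫ ψ = 1 := by
    rw [inv_mul_comp_eq_toUnit_comp_unit ψ a b hab, Hom.one_def]
  -- `a⁻¹ b` factors through the trivial `Ker ψ`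
  have hc : kerLift (a⁻¹ * b) h = toUnit T ≫ η[ker ψ] := by
    rw [← cancel_mono (inv (η[ker ψ] : 𝟙_ (Over S) ⟶ ker ψ)), Category.assoc, IsIso.hom_inv_id,
      Category.comp_id]
    exact toUnit_unique _ _
  have hab' : a⁻¹ * b = 1 := by
    rw [← kerLift_ι (a⁻¹ * b) h, hc, Category.assoc, one_comp_kerι, ← Hom.one_def]
  exact inv_mul_eq_one.mp hab'

/-- The structure map `Ker F → S` is the second projection of the kernel square `Ker F = G ×_{F, G', e} S`.
[cite: GortzWedhorn2020, Definition 4.45 (2) (p. 117)] -/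
theorem snd_left_eq_ker_hom (F : G ⟶ G') :
    (pullback.snd F (η[G'] : 𝟙_ (Over S) ⟶ G')).left = (ker F).hom :=
  (Category.comp_id _).symm.trans (Over.w (pullback.snd F (η[G'] : 𝟙_ (Over S) ⟶ G')))

/-- `Ker F → S` is FINITE when `F` is (base change of `F` along the unit section).
[cite: GortzWedhorn2020, Definition 4.45 (2) (p. 117)] -/
theorem isFinite_ker_hom_of_isFinite_left (F : G ⟶ G') [IsFinite F.left] : IsFinite (ker F).hom := by
  rw [← snd_left_eq_ker_hom F]
  exact MorphismProperty.of_isPullback (P := @IsFinite) (isPullback_kerι_left F) ‹_›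

/-- `Ker F → S` is FLAT when `F` is. [cite: GortzWedhorn2020, Definition 4.45 (2) (p. 117)] -/
theorem flat_ker_hom_of_flat_left (F : G ⟶ G') [Flat F.left] : Flat (ker F).hom := by
  rw [← snd_left_eq_ker_hom F]
  exact MorphismProperty.of_isPullback (P := @Flat) (isPullback_kerι_left F) ‹_›

/-- **The rank of `Ker F → S` at `s` is the rank of the finite flat `F` at the unit point `e(s)`** (ranks are stable
under base change, [StacksProject] Tag 02KA; Mathlib `Scheme.Hom.finrank_of_isPullback`).
[cite: StacksProject, Tag 02KA] [cite: GortzWedhorn2020, Definition 4.45 (2) (p. 117)] -/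
theorem finrank_ker_hom_eq_finrank_left (F : G ⟶ G') [IsFinite F.left] [Flat F.left]
    (s : ↥(𝟙_ (Over S)).left) :
    (ker F).hom.finrank s = F.left.finrank ((η[G'] : 𝟙_ (Over S) ⟶ G').left s) := by
  rw [← snd_left_eq_ker_hom F]
  exact Scheme.Hom.finrank_of_isPullback _ _ _ _ (isPullback_kerι_left F) s

/-- **`Ker F` has at most ONE POINT when `F` is injective on points** (over a one-point base, e.g. a field): every
point `x` of `Ker F ⊆ G` (a closed subscheme, `G'` separated) satisfies `F(ι x) = e_{G'}(s) = F(e_G(s))`, so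
`ι x = e_G(s)`. [cite: MumfordAV1970, §15 (p. 146)] [cite: GortzWedhorn2020, Definition 4.45 (2) (p. 117)] -/
theorem subsingleton_ker_left_of_injective [GrpObj G] [IsSeparated G'.hom] [Subsingleton ↥S] (F : G ⟶ G')
    [IsMonHom F]
    (hF : Function.Injective F.left) : Subsingleton ↥(ker F).left := by
  haveI : IsClosedImmersion (kerι F).left := isClosedImmersion_kerι_left_of_isSeparated F
  haveI : Subsingleton ↥(𝟙_ (Over S)).left := ‹Subsingleton ↥S›
  have hsq := isPullback_kerι_left F
  have hinjι : Function.Injective (kerι F).left := (kerι F).left.isClosedEmbedding.injective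
  have h2 : (η[G] : 𝟙_ (Over S) ⟶ G).left ≫ F.left = (η[G'] : 𝟙_ (Over S) ⟶ G').left := by
    rw [← Over.comp_left, IsMonHom.one_hom]
  -- every point of the kernel is the unit point of `G`
  have key : ∀ x : ↥(ker F).left,
      (kerι F).left x = (η[G] : 𝟙_ (Over S) ⟶ G).left ((pullback.snd F (η[G'] : 𝟙_ (Over S) ⟶ G')).left x) := by
    intro x
    apply hF
    have h1 := congrArg (fun g => g x) hsq.w
    have h3 := congrArg (fun g => g ((pullback.snd F (η[G'] : 𝟙_ (Over S) ⟶ G')).left x)) h2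
    simp only [Scheme.Hom.comp_apply] at h1 h3
    exact h1.trans h3.symm
  refine ⟨fun x y => hinjι ?_⟩
  rw [key x, key y, Subsingleton.elim ((pullback.snd F (η[G'] : 𝟙_ (Over S) ⟶ G')).left x)
    ((pullback.snd F (η[G'] : 𝟙_ (Over S) ⟶ G')).left y)]

end Generic

/-! ## §2 The map induced on kernels by a square of homomorphisms: mono ∕ closed immersion ∕ isomorphism -/

section Square

variable {G H G' H' : Over S} [GrpObj G] [GrpObj H] [GrpObj G'] [GrpObj H']
  (F : G ⟶ G') (F' : H ⟶ H') (φ : G ⟶ H) (φ' : G' ⟶ H')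
  [IsMonHom F] [IsMonHom F'] [IsMonHom φ] [IsMonHom φ']

omit [GrpObj G] [GrpObj H] [IsMonHom F] [IsMonHom F'] [IsMonHom φ] in
/-- For a commuting square of morphisms `φ ≫ F' = F ≫ φ'` with `φ'` a homomorphism, the composite
`Ker F → G → H` is killed by `F'`: `(ι_F ≫ φ) ≫ F' = 1` — the hypothesis of `kerLift` defining the induced map
`Ker F → Ker F'`. [cite: GortzWedhorn2020, Definition 4.45 (2) (p. 117)] -/
theorem kerι_comp_comp_eq_one_of_sq (hsq : φ ≫ F' = F ≫ φ') : (kerι F ≫ φ) ≫ F' = 1 := by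
  rw [Category.assoc, hsq, ← Category.assoc, kerι_comp, MonObj.one_comp]

/-- **THE (E1′) STEP.**  Let `φ ≫ F' = F ≫ φ'` be a commuting square of homomorphisms of `S`-group schemes with
`G'`, `H`, `H'` separated over `S`, `Ker F` a ONE-POINT scheme and `Ker φ → S` unramified (formally unramified and
locally of finite type, e.g. étale).  Then the induced homomorphism `ψ = kerLift (ι_F ≫ φ) : Ker F → Ker F'` is a
MONOMORPHISM: its kernel is a one-point closed subgroup of `Ker F` admitting the unramified homomorphism
`kerLift (ι_ψ ≫ ι_F) : Ker ψ → Ker φ`, hence trivial (★ `isIso_unit_of_subsingleton_of_hom`), and a homomorphism with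
trivial kernel is mono (`mono_of_isIso_unit_ker`). [cite: Tate1997FiniteFlatGroupSchemes, (3.7)]
[cite: MumfordAV1970, §14 (pp. 132–142)] -/
theorem mono_kerLift_of_subsingleton_of_unramified [IsSeparated G'.hom] [IsSeparated H.hom] [IsSeparated H'.hom]
    [Subsingleton ↥(ker F).left] [FormallyUnramified (ker φ).hom] [LocallyOfFiniteType (ker φ).hom]
    (hsq : φ ≫ F' = F ≫ φ') :
    Mono (kerLift (f := F') (kerι F ≫ φ) (kerι_comp_comp_eq_one_of_sq F F' φ φ' hsq)) := by
  haveI hψm : IsMonHom (kerLift (f := F') (kerι F ≫ φ) (kerι_comp_comp_eq_one_of_sq F F' φ φ' hsq)) :=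
    isMonHom_kerLift _ _
  obtain ⟨ψ, hψ⟩ : ∃ ψ, ψ = kerLift (f := F') (kerι F ≫ φ) (kerι_comp_comp_eq_one_of_sq F F' φ φ' hsq) := ⟨_, rfl⟩
  have hψι : ψ ≫ kerι F' = kerι F ≫ φ := by rw [hψ, kerLift_ι]
  rw [← hψ] at hψm ⊢
  -- closed immersions `Ker F → G`, `Ker F' → H`, `Ker φ → G`, `Ker ψ → Ker F`
  haveI : IsClosedImmersion (kerι F).left := isClosedImmersion_kerι_left_of_isSeparated F
  haveI : IsClosedImmersion (kerι F').left := isClosedImmersion_kerι_left_of_isSeparated F'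
  haveI : IsClosedImmersion (kerι φ).left := isClosedImmersion_kerι_left_of_isSeparated φ
  haveI : IsSeparated (ker F').hom := by
    rw [← Over.w (kerι F')]; infer_instance
  haveI hcl : IsClosedImmersion (kerι ψ).left := isClosedImmersion_kerι_left_of_isSeparated ψ
  -- `Ker ψ` has one point
  haveI : Subsingleton ↥(ker ψ).left :=
    ⟨fun x y => hcl.isClosedEmbedding.injective (Subsingleton.elim _ _)⟩
  -- the homomorphism `j = kerLift (ι_ψ ≫ ι_F) : Ker ψ → Ker φ`
  have hj : (kerι ψ ≫ kerι F) ≫ φ = 1 := by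
    rw [Category.assoc, ← hψι, ← Category.assoc, kerι_comp, MonObj.one_comp]
  have hjl : (kerLift (kerι ψ ≫ kerι F) hj).left ≫ (kerι φ).left = (kerι ψ).left ≫ (kerι F).left := by
    rw [← Over.comp_left, kerLift_ι, Over.comp_left]
  haveI : FormallyUnramified (kerLift (kerι ψ ≫ kerι F) hj).left := by
    haveI : FormallyUnramified ((kerLift (kerι ψ ≫ kerι F) hj).left ≫ (kerι φ).left) := by
      rw [hjl]; exact MorphismProperty.comp_mem _ _ _ inferInstance inferInstance
    exact FormallyUnramified.of_comp _ (kerι φ).left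
  haveI : LocallyOfFiniteType (kerLift (kerι ψ ≫ kerι F) hj).left := by
    haveI : LocallyOfFiniteType ((kerLift (kerι ψ ≫ kerι F) hj).left ≫ (kerι φ).left) := by
      rw [hjl]; infer_instance
    exact locallyOfFiniteType_of_comp _ (kerι φ).left
  haveI : IsIso (η[ker ψ] : 𝟙_ (Over S) ⟶ ker ψ) :=
    isIso_unit_of_subsingleton_of_hom (kerLift (kerι ψ ≫ kerι F) hj)
  exact mono_of_isIso_unit_ker ψ

omit [GrpObj G] [GrpObj H] [IsMonHom F] [IsMonHom F'] [IsMonHom φ] in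
/-- `ψ.left` is FINITE when `φ.left` is: `ψ ≫ ι_{F'} = ι_F ≫ φ` is finite (closed immersion, then finite) and
`ι_{F'}` is separated. [cite: GortzWedhorn2020, Definition 4.45 (2) (p. 117)] -/
theorem isFinite_kerLift_left [IsSeparated G'.hom] [IsSeparated H'.hom] [IsFinite φ.left] (hsq : φ ≫ F' = F ≫ φ') :
    IsFinite (kerLift (f := F') (kerι F ≫ φ) (kerι_comp_comp_eq_one_of_sq F F' φ φ' hsq)).left := by
  haveI : IsClosedImmersion (kerι F).left := isClosedImmersion_kerι_left_of_isSeparated F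
  haveI : IsClosedImmersion (kerι F').left := isClosedImmersion_kerι_left_of_isSeparated F'
  have hcomp : IsFinite ((kerLift (f := F') (kerι F ≫ φ) (kerι_comp_comp_eq_one_of_sq F F' φ φ' hsq)).left ≫
      (kerι F').left) := by
    rw [← Over.comp_left, kerLift_ι, Over.comp_left]
    infer_instance
  exact MorphismProperty.of_postcomp (W := @IsFinite) (W' := @IsSeparated) _ (kerι F').left inferInstance hcomp

/-- Under the hypotheses of `mono_kerLift_of_subsingleton_of_unramified` and with `φ.left` finite, `ψ.left` is a
CLOSED IMMERSION (a finite monomorphism, Mathlib `IsClosedImmersion.iff_isFinite_and_mono`).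
[cite: StacksProject, Tag 02KA] [cite: Tate1997FiniteFlatGroupSchemes, (3.7)] -/
theorem isClosedImmersion_kerLift_left_of_subsingleton_of_unramified [IsSeparated G'.hom] [IsSeparated H.hom]
    [IsSeparated H'.hom] [Subsingleton ↥(ker F).left] [FormallyUnramified (ker φ).hom]
    [LocallyOfFiniteType (ker φ).hom] [IsFinite φ.left] (hsq : φ ≫ F' = F ≫ φ') :
    IsClosedImmersion (kerLift (f := F') (kerι F ≫ φ) (kerι_comp_comp_eq_one_of_sq F F' φ φ' hsq)).left := by
  haveI := mono_kerLift_of_subsingleton_of_unramified F F' φ φ' hsq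
  haveI := isFinite_kerLift_left F F' φ φ' hsq
  exact (IsClosedImmersion.iff_isFinite_and_mono _).mpr ⟨‹_›, inferInstance⟩

/-- **The induced map on kernels is an ISOMORPHISM** when, in addition, `Ker F` and `Ker F'` are finite flat over `S`
of the same rank: a closed immersion between finite flat `S`-schemes of equal rank is an isomorphism (★
`Over.isIso_of_isClosedImmersion_of_finrank_eq`). [cite: StacksProject, Tag 02KA]
[cite: Tate1997FiniteFlatGroupSchemes, (3.7)] [cite: MumfordAV1970, §14 (pp. 132–142)] -/
theorem isIso_kerLift_of_finrank_eq [IsSeparated G'.hom] [IsSeparated H.hom] [IsSeparated H'.hom]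
    [Subsingleton ↥(ker F).left] [FormallyUnramified (ker φ).hom] [LocallyOfFiniteType (ker φ).hom]
    [IsFinite φ.left] [IsFinite (ker F').hom] [Flat (ker F').hom] [Flat (ker F).hom]
    (hsq : φ ≫ F' = F ≫ φ') (hrank : ∀ s, (ker F).hom.finrank s = (ker F').hom.finrank s) :
    IsIso (kerLift (f := F') (kerι F ≫ φ) (kerι_comp_comp_eq_one_of_sq F F' φ φ' hsq)) := by
  haveI := isClosedImmersion_kerLift_left_of_subsingleton_of_unramified F F' φ φ' hsq
  exact Morphisms.Over.isIso_of_isClosedImmersion_of_finrank_eq _ hrank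

end Square

end Literature.AlgebraicGeometry.GroupSchemes.GroupSchemeKernel

/-! ## §3 Abelian varieties: the Frobenius kernels -/

namespace Literature.AlgebraicGeometry.Motives.AbelianVariety

open Literature.AlgebraicGeometry.GroupSchemes Literature.AlgebraicGeometry.GroupSchemes.GroupSchemeKernel

variable {k : Type u} [Field k] (p : ℕ) [ExpChar k p] (n : ℕ) {A B : AbelianVariety k} (φ : A ⟶ B)

/-- Naturality `φ ≫ F_B = F_A ≫ φ^{(q)}` of the relative `pⁿ`-Frobenius on the underlying homomorphisms of `k`-group
schemes (★ `relFrobenius_comp`). [cite: MumfordAV1970, §15 (p. 146)] -/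
theorem hom_hom_hom_comp_relFrobenius :
    φ.hom.hom.hom ≫ (B.relFrobenius p n).hom.hom.hom =
      (A.relFrobenius p n).hom.hom.hom ≫ (Hom.frobeniusTwist p n φ).hom.hom.hom :=
  (congrArg (fun f => f.hom.hom.hom) (relFrobenius_comp p n φ)).symm

variable (A)

/-- **`Ker Fⁿ_{A∕k}` has exactly one point** (`Fⁿ_{A∕k}` is injective on points, ★ `relFrobeniusOver_base_bijective`).
[cite: MumfordAV1970, §15 (p. 146)] -/
theorem subsingleton_ker_relFrobenius_left :
    Subsingleton ↥(ker (A.relFrobenius p n).hom.hom.hom).left := by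
  haveI : Subsingleton ↥(Spec (.of k)) := inferInstance
  exact subsingleton_ker_left_of_injective (A.relFrobenius p n).hom.hom.hom
    (relFrobeniusOver_base_bijective p n A.X).1

/-- `Ker Fⁿ_{A∕k} → Spec k` is finite. [cite: MumfordAV1970, §15 (p. 146)] -/
theorem isFinite_ker_relFrobenius_hom : IsFinite (ker (A.relFrobenius p n).hom.hom.hom).hom := by
  haveI : IsFinite (A.relFrobenius p n).hom.hom.hom.left := (A.isIsogeny_relFrobenius p n).2
  exact isFinite_ker_hom_of_isFinite_left _

/-- `Ker Fⁿ_{A∕k} → Spec k` is flat. [cite: MumfordAV1970, §15 (p. 146)] -/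
theorem flat_ker_relFrobenius_hom : Flat (ker (A.relFrobenius p n).hom.hom.hom).hom := by
  haveI : Flat (A.relFrobenius p n).hom.hom.hom.left :=
    IsIsogeny.flat_toSchemeHom_holds (A.isIsogeny_relFrobenius p n)
  exact flat_ker_hom_of_flat_left _

/-- **`Ker Fⁿ_{A∕k}` has rank `p^{n · dim A}`** over the perfect field `k` (the degree of the relative Frobenius, ★
`kerRank_relFrobenius`, read on the kernel through the rank function of the finite flat `F`, ★
`IsIsogeny.finrank_eq_kerRank`). [cite: MumfordAV1970, §15 (p. 146)] [cite: StacksProject, Tag 02KA] -/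
theorem finrank_ker_relFrobenius_hom [PerfectField k] (s : ↥(Spec (.of k))) :
    (ker (A.relFrobenius p n).hom.hom.hom).hom.finrank s = p ^ (n * A.dim) := by
  have hF := A.isIsogeny_relFrobenius p n
  haveI : IsFinite (A.relFrobenius p n).hom.hom.hom.left := hF.2
  haveI : Flat (A.relFrobenius p n).hom.hom.hom.left := IsIsogeny.flat_toSchemeHom_holds hF
  rw [finrank_ker_hom_eq_finrank_left (A.relFrobenius p n).hom.hom.hom s, ← A.kerRank_relFrobenius p n]
  exact hF.finrank_eq_kerRank _

variable {A}

/-- **(o-c3g) AN ISOGENY WITH ÉTALE KERNEL IS AN ISOMORPHISM ON FROBENIUS KERNELS.**  Let `k` be a perfect field of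
exponential characteristic `p`, `φ : A → B` an isogeny of abelian varieties over `k` whose kernel `Ker φ` is ÉTALE
over `k`, and `n : ℕ`.  Then the homomorphism `ψ = kerLift (ι_A ≫ φ) : Ker Fⁿ_{A∕k} → Ker Fⁿ_{B∕k}` induced by `φ` on
the kernels of the relative `pⁿ`-Frobenii (naturality `φ ≫ F_B = F_A ≫ φ^{(pⁿ)}`) is an ISOMORPHISM of `k`-group
schemes. [cite: MumfordAV1970, §14 (pp. 132–142) and §15 (p. 146)] [cite: Tate1997FiniteFlatGroupSchemes, (3.7)]
[cite: StacksProject, Tag 02KA] -/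
theorem isIso_frobKerLift [PerfectField k] (hφ : IsIsogeny φ) (hK : Etale (ker φ.hom.hom.hom).hom) :
    IsIso (kerLift (f := (B.relFrobenius p n).hom.hom.hom)
      (kerι (A.relFrobenius p n).hom.hom.hom ≫ φ.hom.hom.hom)
      (kerι_comp_comp_eq_one_of_sq (A.relFrobenius p n).hom.hom.hom (B.relFrobenius p n).hom.hom.hom
        φ.hom.hom.hom (Hom.frobeniusTwist p n φ).hom.hom.hom (hom_hom_hom_comp_relFrobenius p n φ))) := by
  haveI := hK
  haveI := subsingleton_ker_relFrobenius_left p n A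
  haveI : IsFinite φ.hom.hom.hom.left := hφ.2
  haveI := isFinite_ker_relFrobenius_hom p n B
  haveI := flat_ker_relFrobenius_hom p n A
  haveI := flat_ker_relFrobenius_hom p n B
  refine isIso_kerLift_of_finrank_eq _ _ _ _ (hom_hom_hom_comp_relFrobenius p n φ) fun s => ?_
  rw [finrank_ker_relFrobenius_hom p n A, finrank_ker_relFrobenius_hom p n B, dim_eq_of_isIsogeny hφ]

/-- Underlying `k`-schemes: `ψ.left : Ker Fⁿ_{A∕k} ⥲ Ker Fⁿ_{B∕k}` is an isomorphism.
[cite: MumfordAV1970, §15 (p. 146)] [cite: Tate1997FiniteFlatGroupSchemes, (3.7)] -/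
theorem isIso_frobKerLift_left [PerfectField k] (hφ : IsIsogeny φ) (hK : Etale (ker φ.hom.hom.hom).hom) :
    IsIso (kerLift (f := (B.relFrobenius p n).hom.hom.hom)
      (kerι (A.relFrobenius p n).hom.hom.hom ≫ φ.hom.hom.hom)
      (kerι_comp_comp_eq_one_of_sq (A.relFrobenius p n).hom.hom.hom (B.relFrobenius p n).hom.hom.hom
        φ.hom.hom.hom (Hom.frobeniusTwist p n φ).hom.hom.hom (hom_hom_hom_comp_relFrobenius p n φ))).left := by
  haveI := isIso_frobKerLift p n φ hφ hK
  infer_instance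

end Literature.AlgebraicGeometry.Motives.AbelianVariety

end
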